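import Summits.CriticalPhenomena.PercolationContinuityZ3.Theorems.PercNearOneGluingNoHeavyLowerTailCubicThreePointFibreMask
import HarnessLib

/-!
# `NoHeavyLowerTail` (stmt-CriticalPhenomena-4575) — fibre criterion for SHK3⁺, IV: the bitmask double loop `FibM` (`native_decide`-ready)

Support file (prover prim-sahi-p2; `--supports stmt-CriticalPhenomena-4575`), continuing `…FibreTable` / `…FibreMask`.  For a nested profile
`A = (A₁ ⊇ A₂ ⊇ A₃)` (type-1 edges `P₁ = A₁ ∖ A₂`, type-2 edges `P₂ = A₂ ∖ A₃`, forced `A₃`) the consistent triples are parametrised by the free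
part `X ⊆ P₁ ∪ P₂` of the first copy and the free part `Y ⊆ freeY A X = (P₁ ∖ X) ∪ (P₂ ∩ X)` of the second (`mkS₂`, `eq_mkS₂_of_data3`,
`sum_superset_reindex`, `sum_S₂_reindex`) — `3^{#live}` pairs per profile, the colourings of the three-copy coupling.  In mask form the `Y`-loop
runs over the submasks of a mask (`submasks`, `map_toMask_powerset`), so the loop body is bit arithmetic plus look-ups in a `PolZ` table `pol`,
a cell table `st` and a submask table `sub` (`termM`, `FibM`, `FibFast_eq_FibM`).  MAIN: `shk3W_nonneg_of_fibM` — injective numbering + correct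
tables + `0 ≤ FibM` on all nested profiles ⇒ SHK3⁺ `= F(law) ≥ 0` for ALL edge weights in `[0,1]`.  For the certificates the finite checks are
phrased as FAILURE COUNTS (`fibFailTP`, `cellFailT`: computable `Finset.sum`s, tables by value — a bounded `∀` over a powerset would be decided
by enumerating the whole finite type of configurations), read back by `of_fibFailTP`, `of_cellFailT`.  Used by `…FibreTheta`.
[cite: Gladkov2024StrongFKG, Cor. 4.2 (the cubic row SHK3⁺ ⊇ AG)]
-/

namespace Summit.CriticalPhenomena.PercolationContinuityZ3.Theorems

namespace TerminalGluing

open Finset SimpleGraph Literature.Probability.Percolation Literature.Probability.Percolation.DecisionTree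
open CubicThreePointStep CubicThreePointTerminal

variable {V : Type*} [DecidableEq V]

section Enum

variable (idx : Sym2 V → ℕ) {D : Finset (Sym2 V)}

/-- The free part of the second copy, given the free part `X` of the first copy: type-1 edges outside `X`, type-2 edges inside `X`. [folklore] -/
def freeY (A : Finset (Sym2 V) × Finset (Sym2 V) × Finset (Sym2 V)) (X : Finset (Sym2 V)) : Finset (Sym2 V) :=
  ((A.1 \ A.2.1) \ X) ∪ ((A.2.1 \ A.2.2) ∩ X)

/-- The second copy assembled from its free part `Y`: forced edges, type-2 edges outside `X`, and `Y`. [folklore] -/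
def mkS₂ (A : Finset (Sym2 V) × Finset (Sym2 V) × Finset (Sym2 V)) (X Y : Finset (Sym2 V)) : Finset (Sym2 V) :=
  (A.2.2 ∪ ((A.2.1 \ A.2.2) \ X)) ∪ Y

/-- The base of `mkS₂` is disjoint from the free part. [folklore] -/
theorem mkS₂_inter_freeY {A : Finset (Sym2 V) × Finset (Sym2 V) × Finset (Sym2 V)} (hn : A.2.2 ⊆ A.2.1 ∧ A.2.1 ⊆ A.1)
    (X : Finset (Sym2 V)) {Y : Finset (Sym2 V)} (hY : Y ⊆ freeY A X) : mkS₂ A X Y ∩ freeY A X = Y := by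
  ext e
  have hYe : e ∈ Y → e ∈ freeY A X := fun h => hY h
  have n1 : e ∈ A.2.2 → e ∈ A.2.1 := fun h => hn.1 h
  simp only [mkS₂, freeY, Finset.mem_union, Finset.mem_inter, Finset.mem_sdiff] at hYe ⊢
  by_cases hy : e ∈ Y <;> by_cases hx : e ∈ X <;> by_cases ha1 : e ∈ A.1 <;> by_cases ha2 : e ∈ A.2.1 <;>
    by_cases ha3 : e ∈ A.2.2 <;> simp_all

/-- **Consistent second copies have the form `mkS₂`**: if `(X ∪ A₃, S₂, mk3)` has profile `A` then `S₂ = mkS₂ A X (S₂ ∩ freeY A X)`. [folklore] -/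
theorem eq_mkS₂_of_data3 {A : Finset (Sym2 V) × Finset (Sym2 V) × Finset (Sym2 V)} (hn : A.2.2 ⊆ A.2.1 ∧ A.2.1 ⊆ A.1)
    {X : Finset (Sym2 V)} (hX : X ⊆ A.1 \ A.2.2) {S₂ : Finset (Sym2 V)} (hS₂ : S₂ ⊆ A.1)
    (h : data3 (X ∪ A.2.2) S₂ (mk3 A (X ∪ A.2.2) S₂) = A) : S₂ = mkS₂ A X (S₂ ∩ freeY A X) := by
  obtain ⟨A₁, A₂, A₃⟩ := A
  simp only [data3, Prod.mk.injEq] at h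
  obtain ⟨h1, h2, h3⟩ := h
  ext e
  have e1 := Finset.ext_iff.mp h1 e
  have e2 := Finset.ext_iff.mp h2 e
  have e3 := Finset.ext_iff.mp h3 e
  have n1 : e ∈ A₃ → e ∈ A₂ := fun h => hn.1 h
  have n2 : e ∈ A₂ → e ∈ A₁ := fun h => hn.2 h
  have x1 : e ∈ X → e ∈ A₁ ∧ e ∉ A₃ := fun h => Finset.mem_sdiff.mp (hX h)
  have s1 : e ∈ S₂ → e ∈ A₁ := fun h => hS₂ h
  simp only [mk3, mkS₂, freeY, Finset.mem_union, Finset.mem_inter, Finset.mem_sdiff] at e1 e2 e3 ⊢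
  by_cases hx : e ∈ X <;> by_cases hs : e ∈ S₂ <;> by_cases ha1 : e ∈ A₁ <;> by_cases ha2 : e ∈ A₂ <;>
    by_cases ha3 : e ∈ A₃ <;> simp_all

/-- All submasks of a mask `f` (as a multiset; `y ⊆ f` iff `y &&& f = y`). [folklore] -/
def submasks (f : ℕ) : Multiset ℕ := ((Finset.range (f + 1)).filter (fun y => y &&& f = y)).val

/-- **Masks of the subsets of `F ⊆ D` are exactly the submasks of the mask of `F`** (as multisets, no repetition). [folklore] -/
theorem map_toMask_powerset (hinj : Set.InjOn idx ↑D) {F : Finset (Sym2 V)} (hF : F ⊆ D) :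
    (F.powerset.val).map (toMask idx) = submasks (toMask idx F) := by
  unfold submasks
  have hinjF : ∀ X ∈ F.powerset.val, ∀ Y ∈ F.powerset.val, toMask idx X = toMask idx Y → X = Y := by
    intro X hX Y hY h
    exact toMask_injOn idx hinj ((Finset.mem_powerset.mp (Finset.mem_val.mp hX)).trans hF)
      ((Finset.mem_powerset.mp (Finset.mem_val.mp hY)).trans hF) h
  apply (Multiset.Nodup.ext (Multiset.Nodup.map_on hinjF F.powerset.nodup) (Finset.nodup _)).mpr
  intro y
  rw [Multiset.mem_map, Finset.mem_val, Finset.mem_filter, Finset.mem_range]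
  constructor
  · rintro ⟨Y, hY, rfl⟩
    have hYF : Y ⊆ F := Finset.mem_powerset.mp (Finset.mem_val.mp hY)
    refine ⟨Nat.lt_succ_of_le (Finset.sum_le_sum_of_subset hYF), ?_⟩
    rw [← toMask_inter idx hinj (hYF.trans hF) hF, Finset.inter_eq_left.mpr hYF]
  · rintro ⟨-, hy⟩
    refine ⟨F.filter (fun e => y.testBit (idx e)), Finset.mem_val.mpr (Finset.mem_powerset.mpr (Finset.filter_subset _ _)), ?_⟩
    apply Nat.eq_of_testBit_eq; intro j
    rw [Bool.eq_iff_iff, testBit_toMask idx (hinj.mono (Finset.coe_subset.mpr ((Finset.filter_subset _ _).trans hF)))]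
    constructor
    · rintro ⟨e, he, rfl⟩
      exact (Finset.mem_filter.mp he).2
    · intro hj
      have hfj : (toMask idx F).testBit j = true := by
        have := congrArg (fun n => n.testBit j) hy
        simp only [Nat.testBit_land, hj] at this
        simpa using this
      obtain ⟨e, he, rfl⟩ := (testBit_toMask idx (hinj.mono (Finset.coe_subset.mpr hF)) j).mp hfj
      exact ⟨e, Finset.mem_filter.mpr ⟨he, hj⟩, rfl⟩

variable (pol : Fin 5 → Fin 5 → Fin 5 → ℤ) (st : ℕ → Fin 5) (sub : ℕ → Multiset ℕ)

/-- One term of the mask double sum (`pol` = a table of `PolZ`, `st` = a table of cell labels). [folklore] -/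
def termM (a₁ a₂ a₃ m₁ m₂ : ℕ) : ℤ :=
  if data3M m₁ m₂ (mk3M a₁ a₂ a₃ m₁ m₂) = (a₁, a₂, a₃) then pol (st m₁) (st m₂) (st (mk3M a₁ a₂ a₃ m₁ m₂)) else 0

/-- **The fast fibre sum, bitmask form**: the first copy runs over the masks `x` of `X ⊆ A₁ ∖ A₃` (copy `A₃ ∪ X`), the second over the
CONSISTENT choices only — submasks `y` of the free part `(P₁ ∖ x) ∪ (P₂ ∩ x)` (copy `A₃ ∪ (P₂ ∖ x) ∪ y`), `3^{#live}` iterations per profile —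
with everything inside the loops bit arithmetic plus table look-ups (`pol`, `st`, and `sub` = a table of `submasks`). [folklore] -/
def FibM (A : Finset (Sym2 V) × Finset (Sym2 V) × Finset (Sym2 V)) : ℤ :=
  let a₁ := toMask idx A.1
  let a₂ := toMask idx A.2.1
  let a₃ := toMask idx A.2.2
  let p₁ := toMask idx (A.1 \ A.2.1)
  let p₂ := toMask idx (A.2.1 \ A.2.2)
  (((A.1 \ A.2.2).powerset.val.map (toMask idx)).map (fun x =>
    ((sub (bdiff p₁ x ||| (p₂ &&& x))).map
      (fun y => termM pol st a₁ a₂ a₃ (x ||| a₃) ((a₃ ||| bdiff p₂ x) ||| y))).sum)).sum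

/-- Reindexing the supersets of `A₃` inside `A₁` by their free part. [folklore] -/
theorem sum_superset_reindex {A₁ A₃ : Finset (Sym2 V)} (h : A₃ ⊆ A₁) (f : Finset (Sym2 V) → ℤ) :
    ∑ S ∈ A₁.powerset, (if A₃ ⊆ S then f S else 0) = ∑ X ∈ (A₁ \ A₃).powerset, f (X ∪ A₃) := by
  rw [← Finset.sum_filter]
  have himg : A₁.powerset.filter (fun S => A₃ ⊆ S) = (A₁ \ A₃).powerset.image (fun X => X ∪ A₃) := by
    ext S
    simp only [Finset.mem_filter, Finset.mem_powerset, Finset.mem_image]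
    constructor
    · rintro ⟨hS, hA⟩
      refine ⟨S \ A₃, Finset.sdiff_subset_sdiff hS le_rfl, ?_⟩
      rw [Finset.sdiff_union_of_subset hA]
    · rintro ⟨X, hX, rfl⟩
      exact ⟨Finset.union_subset (hX.trans Finset.sdiff_subset) h, Finset.subset_union_right⟩
  rw [himg, Finset.sum_image]
  intro X hX Y hY hXY
  simp only at hXY
  have hX' : Disjoint X A₃ := Finset.disjoint_of_subset_left (Finset.mem_powerset.mp (Finset.mem_coe.mp hX)) Finset.sdiff_disjoint
  have hY' : Disjoint Y A₃ := Finset.disjoint_of_subset_left (Finset.mem_powerset.mp (Finset.mem_coe.mp hY)) Finset.sdiff_disjoint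
  rw [← Finset.union_sdiff_cancel_right hX', ← Finset.union_sdiff_cancel_right hY', hXY]

/-- Reindexing the consistent second copies by their free part. [folklore] -/
theorem sum_S₂_reindex {A : Finset (Sym2 V) × Finset (Sym2 V) × Finset (Sym2 V)} (hn : A.2.2 ⊆ A.2.1 ∧ A.2.1 ⊆ A.1)
    {X : Finset (Sym2 V)} (hX : X ⊆ A.1 \ A.2.2) (g : Finset (Sym2 V) → ℤ) :
    ∑ S₂ ∈ A.1.powerset, (if A.2.2 ⊆ S₂ ∧ data3 (X ∪ A.2.2) S₂ (mk3 A (X ∪ A.2.2) S₂) = A then g S₂ else 0) =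
      ∑ Y ∈ (freeY A X).powerset,
        (if data3 (X ∪ A.2.2) (mkS₂ A X Y) (mk3 A (X ∪ A.2.2) (mkS₂ A X Y)) = A then g (mkS₂ A X Y) else 0) := by
  have hfree : freeY A X ⊆ A.1 := Finset.union_subset (Finset.sdiff_subset.trans Finset.sdiff_subset)
    (Finset.inter_subset_left.trans (Finset.sdiff_subset.trans hn.2))
  have hmk : ∀ Y, Y ⊆ freeY A X → mkS₂ A X Y ⊆ A.1 := fun Y hY =>
    Finset.union_subset (Finset.union_subset (hn.1.trans hn.2) (Finset.sdiff_subset.trans (Finset.sdiff_subset.trans hn.2)))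
      (hY.trans hfree)
  have hA3 : ∀ Y, A.2.2 ⊆ mkS₂ A X Y := fun Y => Finset.subset_union_left.trans Finset.subset_union_left
  have hre : ∀ Y ∈ (freeY A X).powerset,
      (if data3 (X ∪ A.2.2) (mkS₂ A X Y) (mk3 A (X ∪ A.2.2) (mkS₂ A X Y)) = A then g (mkS₂ A X Y) else 0) =
      (if A.2.2 ⊆ mkS₂ A X Y ∧ data3 (X ∪ A.2.2) (mkS₂ A X Y) (mk3 A (X ∪ A.2.2) (mkS₂ A X Y)) = A then g (mkS₂ A X Y) else 0) := by
    intro Y _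
    by_cases hc : data3 (X ∪ A.2.2) (mkS₂ A X Y) (mk3 A (X ∪ A.2.2) (mkS₂ A X Y)) = A
    · rw [if_pos hc, if_pos ⟨hA3 Y, hc⟩]
    · rw [if_neg hc, if_neg (fun h => hc h.2)]
  rw [Finset.sum_congr rfl hre, ← Finset.sum_image (s := (freeY A X).powerset) (g := mkS₂ A X)
    (f := fun S₂ => if A.2.2 ⊆ S₂ ∧ data3 (X ∪ A.2.2) S₂ (mk3 A (X ∪ A.2.2) S₂) = A then g S₂ else 0)]
  · symm
    apply Finset.sum_subset
    · intro S₂ hS₂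
      obtain ⟨Y, hY, rfl⟩ := Finset.mem_image.mp hS₂
      exact Finset.mem_powerset.mpr (hmk Y (Finset.mem_powerset.mp hY))
    · intro S₂ hS₂ hnot
      rw [if_neg]
      rintro ⟨_, hc⟩
      refine hnot (Finset.mem_image.mpr ⟨S₂ ∩ freeY A X, Finset.mem_powerset.mpr Finset.inter_subset_right, ?_⟩)
      exact (eq_mkS₂_of_data3 hn hX (Finset.mem_powerset.mp hS₂) hc).symm
  · intro Y hY Y' hY' hYY
    have hY1 : Y ⊆ freeY A X := Finset.mem_powerset.mp (Finset.mem_coe.mp hY)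
    have hY2 : Y' ⊆ freeY A X := Finset.mem_powerset.mp (Finset.mem_coe.mp hY')
    rw [← mkS₂_inter_freeY hn X hY1, ← mkS₂_inter_freeY hn X hY2, hYY]

/-- **`FibFast = FibM`**: the table-driven Finset double sum equals the bitmask double loop over consistent pairs (nested profile
inside `D`, `idx` injective on `D`, `pol` a table of `PolZ`). [folklore] -/
theorem FibFast_eq_FibM (hinj : Set.InjOn idx ↑D) (hpol : ∀ s₁ s₂ s₃, pol s₁ s₂ s₃ = PolZ s₁ s₂ s₃)
    (hsub : ∀ f, sub f = submasks f)
    {A : Finset (Sym2 V) × Finset (Sym2 V) × Finset (Sym2 V)} (hA : A.1 ⊆ D) (hn : A.2.2 ⊆ A.2.1 ∧ A.2.1 ⊆ A.1) :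
    FibFast (fun S => st (toMask idx S)) A = FibM idx pol st sub A := by
  have h21 : A.2.1 ⊆ D := hn.2.trans hA
  have h22 : A.2.2 ⊆ D := hn.1.trans h21
  have h31 : A.2.2 ⊆ A.1 := hn.1.trans hn.2
  have hfree : ∀ X, freeY A X ⊆ A.1 := fun X => Finset.union_subset (Finset.sdiff_subset.trans Finset.sdiff_subset)
    (Finset.inter_subset_left.trans (Finset.sdiff_subset.trans hn.2))
  -- the term, in Finset form and in mask form
  have hterm : ∀ S₁, S₁ ⊆ A.1 → ∀ S₂, S₂ ⊆ A.1 →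
      (if data3 S₁ S₂ (mk3 A S₁ S₂) = A then PolZ (st (toMask idx S₁)) (st (toMask idx S₂)) (st (toMask idx (mk3 A S₁ S₂))) else 0)
        = termM pol st (toMask idx A.1) (toMask idx A.2.1) (toMask idx A.2.2) (toMask idx S₁) (toMask idx S₂) := by
    intro S₁ hS₁ S₂ hS₂
    have hm3 : mk3 A S₁ S₂ ⊆ D := by
      unfold mk3
      exact Finset.union_subset (Finset.union_subset h22 (Finset.sdiff_subset.trans (Finset.sdiff_subset.trans h21)))
        (Finset.sdiff_subset.trans (Finset.sdiff_subset.trans hA))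
    unfold termM
    rw [← toMask_mk3 idx hinj hA hn (hS₁.trans hA) (hS₂.trans hA), hpol]
    by_cases h3 : data3 S₁ S₂ (mk3 A S₁ S₂) = A
    · rw [if_pos h3, if_pos ((data3_eq_iff_mask idx hinj hA hn (hS₁.trans hA) (hS₂.trans hA) hm3).mp h3)]
    · rw [if_neg h3, if_neg (fun h => h3 ((data3_eq_iff_mask idx hinj hA hn (hS₁.trans hA) (hS₂.trans hA) hm3).mpr h))]
  -- Step 1: FibFast reindexed over (X, Y)
  have step1 : FibFast (fun S => st (toMask idx S)) A =
      ∑ X ∈ (A.1 \ A.2.2).powerset, ∑ Y ∈ (freeY A X).powerset,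
        termM pol st (toMask idx A.1) (toMask idx A.2.1) (toMask idx A.2.2) (toMask idx X ||| toMask idx A.2.2)
          ((toMask idx A.2.2 ||| toMask idx ((A.2.1 \ A.2.2) \ X)) ||| toMask idx Y) := by
    unfold FibFast
    have hre : ∀ S₁ ∈ A.1.powerset, (∑ S₂ ∈ A.1.powerset,
        (if A.2.2 ⊆ S₁ ∧ A.2.2 ⊆ S₂ ∧ data3 S₁ S₂ (mk3 A S₁ S₂) = A
          then PolZ (st (toMask idx S₁)) (st (toMask idx S₂)) (st (toMask idx (mk3 A S₁ S₂))) else 0)) =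
        if A.2.2 ⊆ S₁ then ∑ S₂ ∈ A.1.powerset, (if A.2.2 ⊆ S₂ ∧ data3 S₁ S₂ (mk3 A S₁ S₂) = A
          then PolZ (st (toMask idx S₁)) (st (toMask idx S₂)) (st (toMask idx (mk3 A S₁ S₂))) else 0) else 0 := by
      intro S₁ _
      by_cases h1 : A.2.2 ⊆ S₁
      · rw [if_pos h1]
        refine Finset.sum_congr rfl fun S₂ _ => ?_
        by_cases h2 : A.2.2 ⊆ S₂ ∧ data3 S₁ S₂ (mk3 A S₁ S₂) = A
        · rw [if_pos ⟨h1, h2⟩, if_pos h2]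
        · rw [if_neg (fun h => h2 h.2), if_neg h2]
      · rw [if_neg h1]
        refine Finset.sum_eq_zero fun S₂ _ => ?_
        rw [if_neg (fun h => h1 h.1)]
    rw [Finset.sum_congr rfl hre, sum_superset_reindex h31]
    refine Finset.sum_congr rfl fun X hX => ?_
    rw [Finset.mem_powerset] at hX
    have hXA : X ⊆ A.1 := hX.trans Finset.sdiff_subset
    have hS₁ : X ∪ A.2.2 ⊆ A.1 := Finset.union_subset hXA h31
    rw [sum_S₂_reindex hn hX]
    refine Finset.sum_congr rfl fun Y hY => ?_
    rw [Finset.mem_powerset] at hY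
    have hYA : Y ⊆ A.1 := hY.trans (hfree X)
    have hb : A.2.2 ∪ ((A.2.1 \ A.2.2) \ X) ⊆ D :=
      Finset.union_subset h22 (Finset.sdiff_subset.trans (Finset.sdiff_subset.trans h21))
    have hS₂ : mkS₂ A X Y ⊆ A.1 :=
      Finset.union_subset (Finset.union_subset h31 (Finset.sdiff_subset.trans (Finset.sdiff_subset.trans hn.2))) hYA
    rw [hterm _ hS₁ _ hS₂, toMask_union idx hinj (hXA.trans hA) h22]
    unfold mkS₂
    rw [toMask_union idx hinj hb (hYA.trans hA), toMask_union idx hinj h22 (Finset.sdiff_subset.trans (Finset.sdiff_subset.trans h21))]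
  -- Step 2: the multiset form
  rw [step1]
  unfold FibM
  simp only [hsub, Multiset.map_map, Function.comp_def, Finset.sum_eq_multiset_sum]
  refine congrArg Multiset.sum (Multiset.map_congr rfl fun X hX => ?_)
  have hXs : X ⊆ A.1 \ A.2.2 := Finset.mem_powerset.mp (Finset.mem_val.mp hX)
  have hXD : X ⊆ D := hXs.trans (Finset.sdiff_subset.trans hA)
  have hP₁ : A.1 \ A.2.1 ⊆ D := Finset.sdiff_subset.trans hA
  have hP₂ : A.2.1 \ A.2.2 ⊆ D := Finset.sdiff_subset.trans h21
  have hfm : toMask idx (freeY A X) = bdiff (toMask idx (A.1 \ A.2.1)) (toMask idx X) ||| (toMask idx (A.2.1 \ A.2.2) &&& toMask idx X) := by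
    unfold freeY
    rw [bdiff_eq, toMask_union idx hinj (Finset.sdiff_subset.trans hP₁) (Finset.inter_subset_left.trans hP₂),
      toMask_sdiff idx hinj hP₁ hXD, toMask_inter idx hinj hP₂ hXD]
  rw [bdiff_eq (toMask idx (A.2.1 \ A.2.2)), ← toMask_sdiff idx hinj hP₂ hXD, ← hfm,
    ← map_toMask_powerset idx hinj ((hfree X).trans hA), Multiset.map_map, Function.comp_def]

/-- The complete finite check as a FAILURE COUNT (a computable triple `Finset.sum`, so that `native_decide` enumerates the powersets as
lists — a bounded `∀` would be decided by enumerating the whole finite type of configurations), restricted to the profiles selected by a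
Boolean predicate `R` (to split long certificates), with the `PolZ` / cell / submask tables passed BY VALUE. [folklore] -/
@[noinline] def fibFailTP (D : Finset (Sym2 V)) (R : Finset (Sym2 V) → Finset (Sym2 V) → Finset (Sym2 V) → Bool)
    (idx : Sym2 V → ℕ) (ptbl : Array ℤ) (tbl : Array (Fin 5)) (stbl : Array (Multiset ℕ)) : ℕ :=
  ∑ A₁ ∈ D.powerset, ∑ A₂ ∈ A₁.powerset, ∑ A₃ ∈ A₂.powerset,
    if R A₁ A₂ A₃ = true then
      (if 0 ≤ FibM idx (fun s₁ s₂ s₃ => ptbl.getD (s₁.val * 25 + s₂.val * 5 + s₃.val) 0) (fun m => tbl.getD m 0)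
        (fun f => if f < stbl.size then stbl.getD f 0 else submasks f) (A₁, A₂, A₃) then 0 else 1)
    else 0

/-- Reading a zero failure count back as the quantified statement. [folklore] -/
theorem of_fibFailTP {D : Finset (Sym2 V)} {R : Finset (Sym2 V) → Finset (Sym2 V) → Finset (Sym2 V) → Bool}
    {idx : Sym2 V → ℕ} {ptbl : Array ℤ} {tbl : Array (Fin 5)} {stbl : Array (Multiset ℕ)}
    (h : fibFailTP D R idx ptbl tbl stbl = 0) :
    ∀ A₁ ∈ D.powerset, ∀ A₂ ∈ A₁.powerset, ∀ A₃ ∈ A₂.powerset, R A₁ A₂ A₃ = true →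
      0 ≤ FibM idx (fun s₁ s₂ s₃ => ptbl.getD (s₁.val * 25 + s₂.val * 5 + s₃.val) 0) (fun m => tbl.getD m 0)
        (fun f => if f < stbl.size then stbl.getD f 0 else submasks f) (A₁, A₂, A₃) := by
  intro A₁ h₁ A₂ h₂ A₃ h₃ hR
  unfold fibFailTP at h
  have e1 := (Finset.sum_eq_zero_iff.mp h) A₁ h₁
  have e2 := (Finset.sum_eq_zero_iff.mp e1) A₂ h₂
  have e3 := (Finset.sum_eq_zero_iff.mp e2) A₃ h₃
  rw [if_pos hR] at e3
  by_contra hc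
  rw [if_neg hc] at e3
  exact one_ne_zero e3

/-- The cell-table check as a failure count (explicit enumeration, table by value). [folklore] -/
@[noinline] def cellFailT [Fintype V] (D : Finset (Sym2 V)) (K : Finset (Sym2 V)) (a b c : V) (idx : Sym2 V → ℕ)
    (tbl : Array (Fin 5)) : ℕ :=
  ∑ S ∈ D.powerset, if cellOK K a b c S (tbl.getD (toMask idx S) 0) = true then 0 else 1

/-- Reading a zero cell-table failure count back as the quantified statement. [folklore] -/
theorem of_cellFailT [Fintype V] {D : Finset (Sym2 V)} {K : Finset (Sym2 V)} {a b c : V} {idx : Sym2 V → ℕ} {tbl : Array (Fin 5)}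
    (h : cellFailT D K a b c idx tbl = 0) :
    ∀ S ∈ D.powerset, cellOK K a b c S ((fun m => tbl.getD m 0) (toMask idx S)) = true := by
  intro S hS
  unfold cellFailT at h
  have e := (Finset.sum_eq_zero_iff.mp h) S hS
  by_contra hc
  rw [if_neg hc] at e
  exact one_ne_zero e

/-- **Fibre criterion, bitmask form** (what a `native_decide` certificate discharges): an edge numbering injective on `D`,
a table `pol` of `PolZ`, a table `sub` of `submasks`, a cell table `st` on masks that is correct on `D.powerset`, and nonnegativity of the bitmask fibre sums
over all nested profiles imply SHK3⁺ for all weights in `[0,1]`. [folklore] -/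
theorem shk3W_nonneg_of_fibM [Fintype V] (D : Finset (Sym2 V)) (K : Finset (Sym2 V)) (a b c : V) (idx : Sym2 V → ℕ)
    (pol : Fin 5 → Fin 5 → Fin 5 → ℤ) (st : ℕ → Fin 5) (sub : ℕ → Multiset ℕ) (p : Sym2 V → ℝ) (hp0 : ∀ e, 0 ≤ p e)
    (hp1 : ∀ e, p e ≤ 1) (hinj : Set.InjOn idx ↑D) (hpol : ∀ s₁ s₂ s₃, pol s₁ s₂ s₃ = PolZ s₁ s₂ s₃) (hsub : ∀ f, sub f = submasks f)
    (hst : ∀ S ∈ D.powerset, cellOK K a b c S (st (toMask idx S)) = true)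
    (hcheck : ∀ A₁ ∈ D.powerset, ∀ A₂ ∈ A₁.powerset, ∀ A₃ ∈ A₂.powerset, 0 ≤ FibM idx pol st sub (A₁, A₂, A₃)) :
    0 ≤ shk3W D p K a b c := by
  refine shk3W_nonneg_of_fibFast D K a b c (fun S => st (toMask idx S)) p hp0 hp1 hst fun A₁ hA₁ A₂ hA₂ A₃ hA₃ => ?_
  rw [FibFast_eq_FibM idx pol st sub hinj hpol hsub (A := (A₁, A₂, A₃)) (Finset.mem_powerset.mp hA₁)
    ⟨Finset.mem_powerset.mp hA₃, Finset.mem_powerset.mp hA₂⟩]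
  exact hcheck A₁ hA₁ A₂ hA₂ A₃ hA₃

end Enum

end TerminalGluing

end Summit.CriticalPhenomena.PercolationContinuityZ3.Theorems
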